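import Literature.NumberTheory.BeurlingPrimes.DeletedPrimes
import Literature.NumberTheory.BeurlingPrimes.IntCountBasic
import Mathlib.NumberTheory.ArithmeticFunction.Moebius
import HarnessLib

/-!
# The `𝒫_𝒮`-free integers by the hyperbola method (Broucke–Debruyne–Révész 2023, §5 p. 16)

Topic `Literature/NumberTheory/BeurlingPrimes`. Everything in this file is PROVED (definitions + theorems).

In the construction of the `[α, β]`-systems with `β < 1/2 < α` (arXiv:2309.01567, Theorem 1.3, second
assertion) one deletes a set `𝒫_𝒮 = S` of rational primes, and "the characteristic function of the remaining
integers `𝒩 = {n ∈ ℕ : p | n ⇒ p ∉ 𝒫_𝒮}` can be written as the convolution `1_𝒩 = 1_ℕ ∗ μ_𝒮`, where … `μ_𝒮`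
is the Möbius function of `𝒫_𝒮`" (p. 16). Given the two Perron estimates for the integers `𝒩_𝒮` of the
Beurling system `𝒫_𝒮`,

  `N_𝒮(x) = a x^α + O_ε(x^{α/2+ε})` and `N_𝒮(x) + M_𝒮(x) = a x^α + O_ε(x^{α/2+ε})`  (p. 16),

BDR conclude: "Applying Lemma 5.1 with the nonnegative functions `h(l) = μ_𝒮(l) + 1_𝒮(l)` and `h(l) = 1_𝒮(l)`
gives, after subtracting them from one another,
`∑_{nl ≤ x, n ∈ ℕ, l ∈ 𝒩_𝒮} μ_𝒮(l) = x/ζ_𝒮(1) + O_ε(x^{2α/(α+2)+ε})`."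

This file carries out exactly this step, for an ARBITRARY set `S` of primes and exponent `0 < α < 1`, with the
two estimates as hypotheses (no named fact is introduced):

* `IsSmooth S n` (all prime factors in `S`: the integers `𝒩_𝒮`), the indicators `smoothInd S = 1_{𝒩_𝒮}`,
  `moebS S = μ_𝒮`, `moebPlusInd S = μ_𝒮 + 1_{𝒩_𝒮} ≥ 0`;
* `sum_divisors_moebS` — `1_𝒩 = 1_ℕ ∗ μ_𝒮`, i.e. `∑_{d | n} μ_𝒮(d) = freeInd S n` (`n ≥ 1`), by
  multiplicativity (Mathlib `ArithmeticFunction.IsMultiplicative.eq_iff_eq_on_prime_powers`);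
* `partialSum_freeInd_eq_sum_floor` — `N'(x) = ∑_{m ≤ x} μ_𝒮(m) ⌊x/m⌋`, and `hypConv_posInd_eq_sum_floor` —
  the hyperbola count of `HyperbolaLemma.lean` with `𝒩 = ℕ₊` (`v = posInd`), `ℒ = ℕ₊` weighted by `h`, `s = 1`
  is `∑_{m ≤ x} h(m) ⌊x/m⌋`;
* `freeCount_asymptotic` — **the conclusion**: `|N'(y) − a y| ≤ C_ε y^{2α/(α+2)+ε}` on `[1, ∞)` for every
  `ε > 0`, with `a = H₁(1) − H₂(1) = ∑_m μ_𝒮(m)/m ≥ 0` (tree `hyperbola_lemma`, twice, exponent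
  `α/(1 + α − δ)` at `δ = α/2 + ε'`).

The positivity `a > 0` (`a = 1/ζ_𝒮(1)`) and the remaining clauses (I), (∂) of
`Literature.Barriers.RiemannHypothesis.isSystem_delSystem_of_estimates` need the analytic continuation of
`ζ(s)/ζ_𝒮(s)` and are treated separately.

## References
* [BrouckeDebruyneRevesz2023] F. Broucke, G. Debruyne, Sz. Gy. Révész, *Some examples of well-behaved Beurling
  number systems*, arXiv:2309.01567 (Trans. AMS 2024), §5 p. 16 and Lemma 5.1 (read).
-/

noncomputable section

open Filter Set Finset ArithmeticFunction
open scoped Topology ArithmeticFunction.zeta ArithmeticFunction.Moebius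

namespace Literature.NumberTheory.BeurlingPrimes

variable (S : Set ℕ)

/-! ### `S`-smooth integers, `μ_𝒮`, and the convolution identity `1_𝒩 = 1 ∗ μ_𝒮` -/

/-- `n` is `S`-smooth: every prime factor of `n` lies in `S` (the integers `𝒩_𝒮` of the Beurling system `𝒫_𝒮`;
`0` and `1` are smooth). [cite: BrouckeDebruyneRevesz2023, §5 p. 16] -/
def IsSmooth (n : ℕ) : Prop := ∀ p ∈ n.primeFactors, p ∈ S

open Classical in
/-- The indicator `1_{𝒩_𝒮}` of the `S`-smooth positive integers. [cite: BrouckeDebruyneRevesz2023, §5 p. 16] -/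
def smoothInd (n : ℕ) : ℝ := if n ≠ 0 ∧ IsSmooth S n then 1 else 0

open Classical in
/-- The Möbius function `μ_𝒮` of `𝒫_𝒮`: `μ(n)` on `S`-smooth `n`, `0` elsewhere ("`μ_𝒮(p_j) = −1`,
`μ_𝒮(p_j^ν) = 0` for `ν ≥ 2`, and `μ_𝒮(p^ν) = 0` for `p ∉ 𝒫_𝒮`, `ν ≥ 1`"). [cite: BrouckeDebruyneRevesz2023, §5 p. 16] -/
def moebS (n : ℕ) : ℝ := if IsSmooth S n then (μ n : ℝ) else 0

/-- BDR's non-negative weight `h = μ_𝒮 + 1_{𝒩_𝒮}` (so that `∑_{l ≤ x} h(l) = M_𝒮(x) + N_𝒮(x)`).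
[cite: BrouckeDebruyneRevesz2023, §5 p. 16] -/
def moebPlusInd (n : ℕ) : ℝ := moebS S n + smoothInd S n

/-- `1` is `S`-smooth. [folklore] -/
theorem isSmooth_one : IsSmooth S 1 := by
  intro p hp; simp at hp

/-- `0` is (vacuously) `S`-smooth. [folklore] -/
theorem isSmooth_zero : IsSmooth S 0 := by
  intro p hp; simp at hp

variable {S}

/-- Smoothness of a product of non-zero numbers. [folklore] -/
theorem isSmooth_mul_iff {m n : ℕ} (hm : m ≠ 0) (hn : n ≠ 0) : IsSmooth S (m * n) ↔ IsSmooth S m ∧ IsSmooth S n := by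
  unfold IsSmooth
  rw [Nat.primeFactors_mul hm hn]
  simp only [Finset.mem_union]
  exact ⟨fun h ↦ ⟨fun p hp ↦ h p (Or.inl hp), fun p hp ↦ h p (Or.inr hp)⟩,
    fun h p hp ↦ hp.elim (h.1 p) (h.2 p)⟩

/-- Freeness of a product of non-zero numbers. [folklore] -/
theorem isFree_mul_iff {m n : ℕ} (hm : m ≠ 0) (hn : n ≠ 0) : IsFree S (m * n) ↔ IsFree S m ∧ IsFree S n := by
  unfold IsFree
  rw [Nat.primeFactors_mul hm hn]
  simp only [Finset.mem_union]
  exact ⟨fun h ↦ ⟨fun p hp ↦ h p (Or.inl hp), fun p hp ↦ h p (Or.inr hp)⟩,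
    fun h p hp ↦ hp.elim (h.1 p) (h.2 p)⟩

/-- A prime power `p^i` (`i ≥ 1`) is `S`-smooth iff `p ∈ S`. [folklore] -/
theorem isSmooth_prime_pow_iff {p i : ℕ} (hp : p.Prime) (hi : i ≠ 0) : IsSmooth S (p ^ i) ↔ p ∈ S := by
  unfold IsSmooth
  rw [Nat.primeFactors_prime_pow hi hp]
  simp

/-- A prime power `p^i` (`i ≥ 1`) is `S`-free iff `p ∉ S`. [folklore] -/
theorem isFree_prime_pow_iff {p i : ℕ} (hp : p.Prime) (hi : i ≠ 0) : IsFree S (p ^ i) ↔ p ∉ S := by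
  unfold IsFree
  rw [Nat.primeFactors_prime_pow hi hp]
  simp

variable (S)

/-- `smoothInd S 0 = 0`. [folklore] -/
@[simp] theorem smoothInd_zero : smoothInd S 0 = 0 := by simp [smoothInd]

/-- `smoothInd S 1 = 1`. [folklore] -/
@[simp] theorem smoothInd_one : smoothInd S 1 = 1 := by simp [smoothInd, isSmooth_one]

/-- `moebS S 0 = 0`. [folklore] -/
@[simp] theorem moebS_zero : moebS S 0 = 0 := by simp [moebS]

/-- `moebS S 1 = 1`. [folklore] -/
@[simp] theorem moebS_one : moebS S 1 = 1 := by simp [moebS, isSmooth_one]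

/-- `moebPlusInd S 0 = 0`. [folklore] -/
@[simp] theorem moebPlusInd_zero : moebPlusInd S 0 = 0 := by simp [moebPlusInd]

/-- `0 ≤ smoothInd ≤ 1`. [folklore] -/
theorem smoothInd_mem_Icc (n : ℕ) : smoothInd S n ∈ Set.Icc (0 : ℝ) 1 := by
  unfold smoothInd; split_ifs <;> norm_num

/-- `|μ_𝒮(n)| ≤ 1`. [folklore] -/
theorem abs_moebS_le_one (n : ℕ) : |moebS S n| ≤ 1 := by
  unfold moebS
  split_ifs
  · have h := ArithmeticFunction.abs_moebius_le_one (n := n)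
    exact_mod_cast h
  · simp

/-- On non-smooth `n` (and at `0`), `μ_𝒮(n) = 0`; otherwise `μ_𝒮(n) = μ(n) ≥ −1 = −1_{𝒩_𝒮}(n)`: `h ≥ 0`.
[cite: BrouckeDebruyneRevesz2023, §5 p. 16 ("the nonnegative functions")] -/
theorem moebPlusInd_nonneg (n : ℕ) : 0 ≤ moebPlusInd S n := by
  unfold moebPlusInd moebS smoothInd
  rcases eq_or_ne n 0 with rfl | hn
  · simp
  · by_cases hs : IsSmooth S n
    · rw [if_pos hs, if_pos ⟨hn, hs⟩]
      have h := ArithmeticFunction.abs_moebius_le_one (n := n)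
      have h' : (-1 : ℝ) ≤ (μ n : ℝ) := by
        have := (abs_le.mp h).1
        exact_mod_cast this
      linarith
    · rw [if_neg hs, if_neg (fun h ↦ hs h.2)]; norm_num

/-- `μ_𝒮` as an arithmetic function. [cite: BrouckeDebruyneRevesz2023, §5 p. 16] -/
def moebSFun : ArithmeticFunction ℝ := ⟨moebS S, moebS_zero S⟩

/-- `1_𝒩` (`= freeInd S`) as an arithmetic function. [cite: BrouckeDebruyneRevesz2023, §5 p. 16] -/
def freeFun : ArithmeticFunction ℝ := ⟨freeInd S, freeInd_zero S⟩

/-- `moebSFun S n = moebS S n`. [folklore] -/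
@[simp] theorem moebSFun_apply (n : ℕ) : moebSFun S n = moebS S n := rfl

/-- `freeFun S n = freeInd S n`. [folklore] -/
@[simp] theorem freeFun_apply (n : ℕ) : freeFun S n = freeInd S n := rfl

/-- `μ_𝒮` is multiplicative. [cite: BrouckeDebruyneRevesz2023, §5 p. 16 ("the multiplicative function defined by …")] -/
theorem isMultiplicative_moebSFun : (moebSFun S).IsMultiplicative := by
  refine ⟨by simp, fun {m n} hmn ↦ ?_⟩
  simp only [moebSFun_apply]
  rcases eq_or_ne m 0 with rfl | hm
  · simp
  rcases eq_or_ne n 0 with rfl | hn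
  · simp
  unfold moebS
  have hμ := ArithmeticFunction.isMultiplicative_moebius.map_mul_of_coprime hmn
  by_cases hsm : IsSmooth S m <;> by_cases hsn : IsSmooth S n
  · rw [if_pos ((isSmooth_mul_iff hm hn).mpr ⟨hsm, hsn⟩), if_pos hsm, if_pos hsn, hμ]; push_cast; rfl
  · rw [if_neg (fun h ↦ hsn ((isSmooth_mul_iff hm hn).mp h).2), if_neg hsn]; simp
  · rw [if_neg (fun h ↦ hsm ((isSmooth_mul_iff hm hn).mp h).1), if_neg hsm]; simp
  · rw [if_neg (fun h ↦ hsm ((isSmooth_mul_iff hm hn).mp h).1), if_neg hsm]; simp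

/-- `1_𝒩` is multiplicative. [folklore] -/
theorem isMultiplicative_freeFun : (freeFun S).IsMultiplicative := by
  classical
  refine ⟨by simp, fun {m n} hmn ↦ ?_⟩
  simp only [freeFun_apply]
  rcases eq_or_ne m 0 with rfl | hm
  · simp
  rcases eq_or_ne n 0 with rfl | hn
  · simp
  unfold freeInd
  by_cases hfm : IsFree S m <;> by_cases hfn : IsFree S n
  · rw [if_pos ⟨mul_ne_zero hm hn, (isFree_mul_iff hm hn).mpr ⟨hfm, hfn⟩⟩, if_pos ⟨hm, hfm⟩, if_pos ⟨hn, hfn⟩]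
    norm_num
  · rw [if_neg (fun h ↦ hfn ((isFree_mul_iff hm hn).mp h.2).2), if_neg (fun h : n ≠ 0 ∧ IsFree S n ↦ hfn h.2)]
    simp
  · rw [if_neg (fun h ↦ hfm ((isFree_mul_iff hm hn).mp h.2).1), if_neg (fun h : m ≠ 0 ∧ IsFree S m ↦ hfm h.2)]
    simp
  · rw [if_neg (fun h ↦ hfm ((isFree_mul_iff hm hn).mp h.2).1), if_neg (fun h : m ≠ 0 ∧ IsFree S m ↦ hfm h.2)]
    simp

/-- **`1_𝒩 = μ_𝒮 ∗ 1`** as arithmetic functions: both sides are multiplicative and agree on prime powers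
(`∑_{j ≤ i} μ_𝒮(p^j) = 1 − 1_S(p) = 1_𝒩(p^i)` for `i ≥ 1`). [cite: BrouckeDebruyneRevesz2023, §5 p. 16 ("`1_𝒩 = 1_ℕ ∗ μ_𝒮`")] -/
theorem moebSFun_mul_zeta : moebSFun S * (ζ : ArithmeticFunction ℝ) = freeFun S := by
  classical
  rw [ArithmeticFunction.IsMultiplicative.eq_iff_eq_on_prime_powers _
    ((isMultiplicative_moebSFun S).mul isMultiplicative_zeta.natCast) _ (isMultiplicative_freeFun S)]
  intro p i hp
  rw [coe_mul_zeta_apply, Nat.sum_divisors_prime_pow hp]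
  simp only [moebSFun_apply, freeFun_apply]
  rcases Nat.eq_zero_or_pos i with rfl | hi
  · simp
  · -- `∑_{j ≤ i} μ_𝒮(p^j) = 1 + μ_𝒮(p)`, the terms `j ≥ 2` vanishing
    rw [Finset.sum_range_succ', pow_zero, moebS_one]
    have htail : ∑ j ∈ Finset.range i, moebS S (p ^ (j + 1)) = moebS S p := by
      rw [Finset.sum_eq_single_of_mem 0 (Finset.mem_range.mpr hi)]
      · simp
      · intro j _ hj
        unfold moebS
        split_ifs
        · rw [ArithmeticFunction.moebius_apply_prime_pow hp (Nat.succ_ne_zero j), if_neg (by omega)]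
          simp
        · rfl
    rw [htail]
    unfold moebS freeInd
    have hsm : IsSmooth S p ↔ p ∈ S := by
      have := isSmooth_prime_pow_iff (S := S) (i := 1) hp one_ne_zero
      rwa [pow_one] at this
    rw [ArithmeticFunction.moebius_apply_prime hp]
    simp only [hsm]
    have hpi : p ^ i ≠ 0 := pow_ne_zero _ hp.ne_zero
    by_cases hpS : p ∈ S
    · rw [if_pos hpS, if_neg (fun h ↦ (isFree_prime_pow_iff hp hi.ne').mp h.2 hpS)]; norm_num
    · rw [if_neg hpS, if_pos ⟨hpi, (isFree_prime_pow_iff hp hi.ne').mpr hpS⟩]; norm_num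

/-- **`∑_{d | n} μ_𝒮(d) = 1_𝒩(n)`** for `n ≥ 1`. [cite: BrouckeDebruyneRevesz2023, §5 p. 16 ("`1_𝒩 = 1_ℕ ∗ μ_𝒮`")] -/
theorem sum_divisors_moebS (n : ℕ) : ∑ d ∈ n.divisors, moebS S d = freeInd S n := by
  have h := congrArg (fun f : ArithmeticFunction ℝ ↦ f n) (moebSFun_mul_zeta S)
  simpa only [coe_mul_zeta_apply, moebSFun_apply, freeFun_apply] using h

/-! ### `N'(x) = ∑_{m ≤ x} μ_𝒮(m) ⌊x/m⌋` and the hyperbola count with `𝒩 = ℕ₊`, `s = 1` -/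

/-- Swapping a divisor sum: `∑_{k ≤ X} ∑_{d | k} f(d) = ∑_{d ≤ X} f(d) ⌊X/d⌋`. [folklore] -/
theorem sum_sum_divisors_eq (f : ℕ → ℝ) (X : ℕ) :
    ∑ k ∈ Finset.Icc 0 X, ∑ d ∈ k.divisors, f d = ∑ d ∈ Finset.Icc 0 X, f d * (X / d : ℕ) := by
  classical
  -- write the divisor sum as a filtered sum over `[0, X]`
  have h1 : ∀ k ∈ Finset.Icc 0 X, ∑ d ∈ k.divisors, f d =
      ∑ d ∈ Finset.Icc 0 X, if d ∣ k ∧ k ≠ 0 then f d else 0 := by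
    intro k hk
    rw [← Finset.sum_filter]
    congr 1
    ext d
    simp only [Nat.mem_divisors, Finset.mem_filter, Finset.mem_Icc, Nat.zero_le, true_and]
    constructor
    · rintro ⟨hd, hk0⟩
      exact ⟨le_trans (Nat.le_of_dvd (Nat.pos_of_ne_zero hk0) hd) (Finset.mem_Icc.mp hk).2, hd, hk0⟩
    · rintro ⟨-, hd, hk0⟩; exact ⟨hd, hk0⟩
  rw [Finset.sum_congr rfl h1, Finset.sum_comm]
  refine Finset.sum_congr rfl fun d _ ↦ ?_
  rw [← Finset.sum_filter, Finset.sum_const, nsmul_eq_mul, mul_comm]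
  congr 1
  have h2 : (Finset.Icc 0 X).filter (fun k ↦ d ∣ k ∧ k ≠ 0) = (Finset.Ioc 0 X).filter (fun k ↦ d ∣ k) := by
    ext k
    simp only [Finset.mem_filter, Finset.mem_Icc, Finset.mem_Ioc, Nat.zero_le, true_and]
    constructor
    · rintro ⟨hk, hd, hk0⟩; exact ⟨⟨Nat.pos_of_ne_zero hk0, hk⟩, hd⟩
    · rintro ⟨⟨hk0, hk⟩, hd⟩; exact ⟨hk, hd, hk0.ne'⟩
  rw [h2, Nat.Ioc_filter_dvd_card_eq_div]

/-- **`N'(x) = ∑_{m ≤ x} μ_𝒮(m) ⌊x/m⌋`** (`= ∑_{k ≤ x} ∑_{d | k} μ_𝒮(d)`). [cite: BrouckeDebruyneRevesz2023, §5 p. 16] -/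
theorem partialSum_freeInd_eq_sum_floor (x : ℝ) :
    partialSum (freeInd S) x = ∑ m ∈ Finset.Icc 0 ⌊x⌋₊, moebS S m * (⌊x / m⌋₊ : ℝ) := by
  unfold partialSum
  rw [← Finset.sum_congr rfl (fun k _ ↦ sum_divisors_moebS S k), sum_sum_divisors_eq]
  refine Finset.sum_congr rfl fun m _ ↦ ?_
  rw [Nat.floor_div_natCast]

/-- **The hyperbola count for `𝒩 = ℕ₊`, `ℒ = ℕ₊` weighted by `h`, `s = 1`**: for `x ≥ 1`,
`∑_{nm ≤ x} 1·h(m) = ∑_{m ≤ x} h(m) ⌊x/m⌋` (the hyperbola identity of `HyperbolaLemma.lean` at `y = 1`).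
[cite: BrouckeDebruyneRevesz2023, Lemma 5.1 (proof)] -/
theorem hypConv_posInd_eq_sum_floor (h : ℕ → ℝ) (hh0 : h 0 = 0) {x : ℝ} (hx : 1 ≤ x) :
    hypConv posInd h 1 x = ∑ m ∈ Finset.Icc 0 ⌊x⌋₊, h m * (⌊x / m⌋₊ : ℝ) := by
  have hid := hypConv_eq posInd h 1 posInd_zero hh0 le_rfl le_rfl hx
  rw [hid, Nat.floor_one, inv_one, Real.rpow_one, div_one, partialSum_posInd, Nat.floor_one, Nat.cast_one, one_mul]
  have h01 : Finset.Icc 0 1 = ({0, 1} : Finset ℕ) := by decide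
  rw [h01, Finset.sum_pair (by norm_num), posInd_zero, zero_mul, zero_add, posInd_of_ne_zero one_ne_zero,
    Nat.cast_one, div_one, Real.rpow_one, one_mul, add_sub_cancel_left]
  refine Finset.sum_congr rfl fun m _ ↦ ?_
  rw [Real.rpow_one, partialSum_posInd]

/-- `N'(x)` as a difference of two hyperbola counts with NON-NEGATIVE weights:
`N'(x) = ∑_{nm ≤ x} (μ_𝒮 + 1_{𝒩_𝒮})(m) − ∑_{nm ≤ x} 1_{𝒩_𝒮}(m)` (`x ≥ 1`).
[cite: BrouckeDebruyneRevesz2023, §5 p. 16 ("after subtracting them from one another")] -/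
theorem partialSum_freeInd_eq_hypConv_sub {x : ℝ} (hx : 1 ≤ x) :
    partialSum (freeInd S) x = hypConv posInd (moebPlusInd S) 1 x - hypConv posInd (smoothInd S) 1 x := by
  rw [hypConv_posInd_eq_sum_floor _ (moebPlusInd_zero S) hx, hypConv_posInd_eq_sum_floor _ (smoothInd_zero S) hx,
    partialSum_freeInd_eq_sum_floor, ← Finset.sum_sub_distrib]
  refine Finset.sum_congr rfl fun m _ ↦ ?_
  rw [moebPlusInd]; ring

/-! ### The asymptotic formula for `N'` -/

/-- `|⌊t⌋ − t| ≤ 1 = 1·t⁰`: the integers have `a = 1`, `γ = 0` in Lemma 5.1. [folklore] -/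
theorem abs_partialSum_posInd_sub_le (t : ℝ) (ht : 1 ≤ t) : |partialSum posInd t - 1 * t| ≤ 1 * t ^ (0 : ℝ) := by
  rw [partialSum_posInd, Real.rpow_zero, one_mul, one_mul, abs_le]
  have h1 := Nat.floor_le (show 0 ≤ t by linarith)
  have h2 := Nat.lt_floor_add_one t
  constructor <;> linarith

/-- A non-negative counting function with `|A(y) − a y| ≤ C y^θ` (`θ < 1`) on `[1, ∞)` has `a ≥ 0`. [folklore] -/
theorem density_nonneg {A : ℝ → ℝ} (hA0 : ∀ y, 1 ≤ y → 0 ≤ A y) {a C θ : ℝ} (hθ : θ < 1)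
    (hA : ∀ y, 1 ≤ y → |A y - a * y| ≤ C * y ^ θ) : 0 ≤ a := by
  by_contra ha
  push Not at ha
  -- eventually `C y^θ < (−a) y`
  have hev := eventually_const_mul_rpow_lt (show θ - 1 < 0 by linarith) C (show 0 < -a by linarith)
  obtain ⟨y, hy⟩ := (hev.and (eventually_ge_atTop 1)).exists
  obtain ⟨hlt, hy1⟩ := hy
  have hy0 : 0 < y := by linarith
  have h1 := hA y hy1
  have h2 := hA0 y hy1
  have h3 : A y - a * y ≤ C * y ^ θ := (le_abs_self _).trans h1
  have h4 : C * y ^ θ = C * y ^ (θ - 1) * y := by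
    rw [mul_assoc, ← Real.rpow_add_one hy0.ne' (θ - 1)]; ring_nf
  rw [h4] at h3
  nlinarith

/-- **The `𝒫_𝒮`-free integers by the hyperbola method.** Let `S` be any set, `0 < α < 1`, and suppose the
`S`-smooth integers satisfy `N_𝒮(u) = a_𝒮 u^α + O_ε(u^{α/2+ε})` and `N_𝒮(u) + M_𝒮(u) = a_𝒮 u^α + O_ε(u^{α/2+ε})` on
`[1, ∞)` for every `ε > 0`. Then the `S`-free integers satisfy `N'(y) = a y + O_ε(y^{2α/(α+2)+ε})` on `[1, ∞)`
for every `ε > 0`, with `a = H₁(1) − H₂(1)` (`= ∑_m μ_𝒮(m)/m = 1/ζ_𝒮(1)`) `≥ 0`: Lemma 5.1 with `𝒩 = ℕ`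
(`a = 1`, `γ = 0`), `ℒ = 𝒩_𝒮` weighted by `h = μ_𝒮 + 1_𝒮 ≥ 0`, resp. `h = 1_𝒮` (`b = a_𝒮`, `β = α`, `δ = α/2 + ε'`),
error exponent `α/(1 + α − δ) ≤ 2α/(α+2) + ε`; the `x^α`-terms cancel on subtraction.
[cite: BrouckeDebruyneRevesz2023, §5 p. 16] -/
theorem freeCount_asymptotic {α : ℝ} (hα0 : 0 < α) (hα1 : α < 1) {aS : ℝ}
    (hN : ∀ ε : ℝ, 0 < ε → ∃ C : ℝ, ∀ u : ℝ, 1 ≤ u → |partialSum (smoothInd S) u - aS * u ^ α| ≤ C * u ^ (α / 2 + ε))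
    (hNM : ∀ ε : ℝ, 0 < ε → ∃ C : ℝ, ∀ u : ℝ, 1 ≤ u →
      |partialSum (moebPlusInd S) u - aS * u ^ α| ≤ C * u ^ (α / 2 + ε)) :
    ∃ a : ℝ, 0 ≤ a ∧ a = hypH (moebPlusInd S) 1 - hypH (smoothInd S) 1 ∧
      ∀ ε : ℝ, 0 < ε → ∃ C : ℝ, ∀ y : ℝ, 1 ≤ y →
        |partialSum (freeInd S) y - a * y| ≤ C * y ^ (2 * α / (α + 2) + ε) := by
  set a : ℝ := hypH (moebPlusInd S) 1 - hypH (smoothInd S) 1 with ha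
  -- the estimate for every `ε`
  have hmain : ∀ ε : ℝ, 0 < ε → ∃ C : ℝ, ∀ y : ℝ, 1 ≤ y →
      |partialSum (freeInd S) y - a * y| ≤ C * y ^ (2 * α / (α + 2) + ε) := by
    intro ε hε
    -- choose `ε' ≤ min(ε/2, α/4)` and `δ = α/2 + ε'`
    set ε' : ℝ := min (ε / 2) (α / 4) with hε'
    have hε'0 : 0 < ε' := lt_min (by linarith) (by linarith)
    have hε'1 : ε' ≤ ε / 2 := min_le_left _ _
    have hε'2 : ε' ≤ α / 4 := min_le_right _ _
    set δ : ℝ := α / 2 + ε' with hδ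
    have hδ0 : 0 ≤ δ := by rw [hδ]; linarith
    have hδα : δ < α := by rw [hδ]; linarith
    obtain ⟨C₁, hC₁⟩ := hNM ε' hε'0
    obtain ⟨C₂, hC₂⟩ := hN ε' hε'0
    have hL₁ : ∀ u, 1 ≤ u → |partialSum (moebPlusInd S) (u ^ (1 : ℝ)⁻¹) - aS * u ^ α| ≤ C₁ * u ^ δ := by
      intro u hu; rw [inv_one, Real.rpow_one]; exact hC₁ u hu
    have hL₂ : ∀ u, 1 ≤ u → |partialSum (smoothInd S) (u ^ (1 : ℝ)⁻¹) - aS * u ^ α| ≤ C₂ * u ^ δ := by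
      intro u hu; rw [inv_one, Real.rpow_one]; exact hC₂ u hu
    obtain ⟨-, -, K₁, hK₁⟩ := hyperbola_lemma posInd (moebPlusInd S) 1 posInd_zero posInd_nonneg (moebPlusInd_zero S)
      (moebPlusInd_nonneg S) le_rfl le_rfl hα0 hδ0 hδα hα1 abs_partialSum_posInd_sub_le hL₁
    obtain ⟨-, -, K₂, hK₂⟩ := hyperbola_lemma posInd (smoothInd S) 1 posInd_zero posInd_nonneg (smoothInd_zero S)
      (fun n ↦ (smoothInd_mem_Icc S n).1) le_rfl le_rfl hα0 hδ0 hδα hα1 abs_partialSum_posInd_sub_le hL₂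
    -- the common exponent `θ = α/(1 + α − δ) ≤ 2α/(α+2) + ε`
    set θ : ℝ := (α - 0 * δ) / (1 - 0 + α - δ) with hθ
    have hθeq : θ = α / (1 + α - δ) := by rw [hθ]; ring_nf
    have hden : 0 < 1 + α - δ := by linarith
    have hθle : θ ≤ 2 * α / (α + 2) + ε := by
      rw [hθeq, div_le_iff₀ hden]
      have h2 : 2 * α / (α + 2) * (1 + α - δ) = 2 * α / (α + 2) * (1 + α / 2) - 2 * α / (α + 2) * ε' := by
        rw [hδ]; ring
      have h3 : 2 * α / (α + 2) * (1 + α / 2) = α := by field_simp; ring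
      have h4 : 2 * α / (α + 2) ≤ 1 := by rw [div_le_one (by linarith)]; linarith
      have h5 : 0 ≤ 2 * α / (α + 2) := by positivity
      have h6 : ε * (1 + α - δ) ≥ ε * (1 / 2) := by
        refine mul_le_mul_of_nonneg_left ?_ hε.le
        rw [hδ]; linarith
      nlinarith [mul_le_mul_of_nonneg_right h4 hε'0.le]
    refine ⟨|K₁| + |K₂|, fun y hy ↦ ?_⟩
    have hy0 : 0 < y := by linarith
    have h1 := hK₁ y hy
    have h2 := hK₂ y hy
    rw [partialSum_freeInd_eq_hypConv_sub S hy]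
    have hyθ : y ^ θ ≤ y ^ (2 * α / (α + 2) + ε) := Real.rpow_le_rpow_of_exponent_le hy hθle
    have hyθ0 : 0 ≤ y ^ θ := Real.rpow_nonneg hy0.le _
    -- subtract the two expansions: the `x^α` terms cancel
    have e : hypConv posInd (moebPlusInd S) 1 y - hypConv posInd (smoothInd S) 1 y - a * y =
        (hypConv posInd (moebPlusInd S) 1 y - (1 * hypH (moebPlusInd S) 1 * y + aS * abelConst posInd 1 α * y ^ α)) -
        (hypConv posInd (smoothInd S) 1 y - (1 * hypH (smoothInd S) 1 * y + aS * abelConst posInd 1 α * y ^ α)) := by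
      rw [ha]; ring
    rw [e]
    calc |(hypConv posInd (moebPlusInd S) 1 y - (1 * hypH (moebPlusInd S) 1 * y + aS * abelConst posInd 1 α * y ^ α)) -
          (hypConv posInd (smoothInd S) 1 y - (1 * hypH (smoothInd S) 1 * y + aS * abelConst posInd 1 α * y ^ α))|
        ≤ K₁ * y ^ θ + K₂ * y ^ θ := (abs_sub _ _).trans (add_le_add h1 h2)
      _ ≤ |K₁| * y ^ θ + |K₂| * y ^ θ := by
          gcongr <;> exact le_abs_self _
      _ = (|K₁| + |K₂|) * y ^ θ := by ring
      _ ≤ (|K₁| + |K₂|) * y ^ (2 * α / (α + 2) + ε) := mul_le_mul_of_nonneg_left hyθ (by positivity)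
  -- positivity of `a` from `N' ≥ 0`
  have ha0 : 0 ≤ a := by
    have hb : 2 * α / (α + 2) < 1 := by rw [div_lt_one (by linarith)]; linarith
    set ε₀ : ℝ := (1 - 2 * α / (α + 2)) / 2 with hε₀
    have hε₀0 : 0 < ε₀ := by rw [hε₀]; linarith
    obtain ⟨C, hC⟩ := hmain ε₀ hε₀0
    refine density_nonneg (fun y _ ↦ ?_) (show 2 * α / (α + 2) + ε₀ < 1 by rw [hε₀]; linarith) hC
    exact Finset.sum_nonneg fun k _ ↦ freeInd_nonneg S k
  exact ⟨a, ha0, rfl, hmain⟩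

end Literature.NumberTheory.BeurlingPrimes
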